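/-
Copyright: statement-level skeleton of a published paper (lit-balaban cell, Phase-2 proof seat p13, gen 7). No proof
claims beyond what the kernel checks below.
-/
import Literature.MathematicalPhysics.QuantumFieldTheory.BalabanImbrieJaffe1984to88.BIJ88Eq248Lattice
import Literature.MathematicalPhysics.QuantumFieldTheory.BalabanImbrieJaffe1984to88.BIJ88Ineq246Walks

/-!
# `BalabanImbrieJaffe1984to88.BIJ88DirichletReplacement292` — T. Bałaban, J. Imbrie, A. Jaffe, *Effective action and
cluster properties of the abelian Higgs model*, Commun. Math. Phys. **114** (1988) 257–315 [BalabanImbrieJaffe1988]: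
Sect. 5.7, p. 292 — REPLACING THE DIRICHLET REGION OF A SINGLE-SCALE PROPAGATOR BY THE RANDOM WALK EXPANSION:
*"Using the random walk expansions we can write the difference as Σ_X C^{(j)′}(X), with |C^{(j)′}(X, x₁, x₂)| ≦
e^{−c|x₁−x₂|}e^{−cr(e_k)|X|}"*, PROVED for the `ℤ^d` operators of [6] = [Balaban1983RegularityDecay] Sect. 5 («model
instance»)

statement-level skeleton of published theorems with citation tags; proofs where landed; nothing here is a claim about the Yang–Mills mass gap

PDF held: `paper:balaban1988-cmp114-bij-abelian-higgs-effective-action` (journal page = PDF page + 256); p. 292 [PDF 36]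
read as an IMAGE (CCITT render `pages/original-p036-x2.png` in the seat folder).

CITATION HEADER (lean-in-tree rule).  Part of the lit-balaban TYPED SKELETON (HOME `run/shared/lean/pub/lit-balaban/`):
WHAT IS REPRODUCED = row **C2.Eq5.7.10-5.7.12** of `HOME/lit-balaban-r16/ROWS-C2-part2.md` (p. 291–294, *"replacements
C^{(j)}_{Λ^{(j)}_{10}} → C^{(j)}_{B_{m−j}(Λ^{(m)}_3)} … each with localized remainders"*), the p. 292 replacement sentence;
unit `lit-balaban-p13` (gen 7), owner r16, referee ref-5.  Built BY NAME on this seat's `BIJ88Eq242Lattice` (gen 2/5: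
`latticeCw`, `eq245_lattice`, `eq245_compress`), `BIJ88Ineq246Lattice` (gen 5: `abs_tsum_class_le`,
`plen_ge_of_region`, `sdist_le_plen_add_two`, `tsum_indicator_latticeCw_eq`, `Cubes`, `cubeOf`, `touch`, `ldist`,
`sdist`, `thetaW`), `BIJ88Eq248Lattice` (gen 5: `FarFromCompl`, `XFar`, `eCube`, `cLoc_eq_of_far`, `cX_eq_of_far`) and
on `BIJ88RandomWalk242` (gen 2: `cLoc`, `cX`) / p36's `BIJ88Ineq246Walks.cX_empty`; nothing restated.

## The print (p. 292 [PDF 36], verbatim)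

*"Next we take an m > j and we try to replace each C^{(j)}_{Λ^{(j)}_{10}}(u_{k+1}) with C^{(j)}_{B_{m−j}(Λ^{(m)}_3)}(u_{k+1}).
Using the random walk expansions we can write the difference as Σ_X C^{(j)′}(X), with |C^{(j)′}(X, x₁, x₂)| ≦
e^{−c|x₁−x₂|}e^{−cr(e_k)|X|} for x₁, x₂ in B_{m−j}(Λ^{(m)}_4). For m > j, all operators C^{(j)}_{Λ^{(j)}_{10}}(u_{k+1}) in
our low order expansion satisfy this restriction."*  The two operators are the Dirichlet restrictions (2.39)
`C^{(j)}_Λ(u) = [(Δ(u) + aL^{−2}Q(u)*Q(u))|_Λ]^{−1}` of ONE operator to two regions `Λ′ = B_{m−j}(Λ^{(m)}_3) ⊂ Λ = Λ^{(j)}_{10}`,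
and *"the random walk expansions"* are (2.42)–(2.48) (the resummed form (2.45) for both regions, (2.46) for the
`X`-parts, (2.47)/(2.41) for the decay in `|x₁ − x₂|`, (2.48) for the region-independence of the local part and of
the parts `C_{Λ,X}` with `X` away from the boundary).

## The typing (model instance, READING declared)

The `ℤ^d` operator model of [6] Sect. 5 used for (2.42)–(2.48) in this directory: `A` an operator on `L²(Ω; ℝ^N)`,
`Ω ⊂ ℤ^d` finite (here `Ω` plays the print's LARGER region `Λ^{(j)}_{10}`), with [6] (5.6) (`B4.Hyp56 Ω A γ₀ c₀ δ₀`); the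
SMALLER region is `Λ ⊆ Ω` with Dirichlet restriction `A_Λ = B4.compress hΛ A` ((2.39), `B6GOmega`); cubes of `M ≥ 5`
labels, `r(e_k)`-cubes of `s` labels a side (`Cubes M s`, `cubeOf M s`, `touch`), primed radius `ρ` (`= s/4` for the
bounds); `C_Ω := A^{−1}`, `C_Λ := A_Λ^{−1}`; their local parts and `X`-parts `cLoc`/`cX` of the lattice walk kernels
`latticeCw`.  THE DIFFERENCE TERM `C′(X)`, `X` a set of `r(e_k)`-cubes of `Ω`:
`C′(X)(x₁,x₂) := C_{Ω,X}(x₁,x₂) − Σ_{Y : ι(Y) = X} C_{Λ,Y}(x₁,x₂)` (`ι` = the injective push-forward of cube sets of `Λ`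
to cube sets of `Ω`, `BIJ88Eq248Lattice.eCube`; the fibre has at most one element).
* **`sub_eq_sum_diffTerm`** — *"we can write the difference as Σ_X C^{(j)′}(X)"*: for `x₁, x₂ ∈ Λ` with `x₁` farther
  than `(ρ + 2)M` from `Ω∖Λ` (`FarFromCompl`, the print's *"for x₁, x₂ in B_{m−j}(Λ^{(m)}_4)"*),
  `C_Ω(x₁,x₂) − C_Λ(x₁,x₂) = Σ_X C′(X)(x₁,x₂)` — from (2.45) for both regions and (2.48) for the local parts.
* `diffTerm_eq_zero_of_far` — the terms with `X = ι(Y)`, `Y` away from the boundary (`XFar`), VANISH ((2.48) first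
  clause): only `X` reaching `Ω∖Λ` contribute.
* **`abs_cX_lattice_le_two`** (the mechanism, new): the TWO-FACTOR form of (2.46) for these operators,
  `|C_{Λ,X}(x₁,x₂)| ≤ K₂·e^{−(δ₀/16)·|x₁−x₂|/M}·e^{−(δ₀s/(128·9^d))·|X|}`, `K₂ = 2^dγ₀^{−1}(1−θ_W)^{−1}e^{3δ₀/16}` — a
  contributing walk of the class `X` has path length both `≥ (s/(8·9^d))|X| − 1` and `≥ |x₁−x₂|/M − 2`, hence `≥` their
  mean.
* **`abs_diffTerm_le`** — *"|C^{(j)′}(X, x₁, x₂)| ≦ e^{−c|x₁−x₂|}e^{−cr(e_k)|X|}"* with explicit constants: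
  `|C′(X)(x₁,x₂)| ≤ 2K₂·e^{−(δ₀/16)·|x₁−x₂|/M}·e^{−(δ₀s/(128·9^d))·|X|}`; **`abs_diffTerm_le_printed`** — the printed
  one-constant-free form `≤ e^{−(δ₀/16)|x₁−x₂|/M}·e^{−c′·s·|X|}`, `c′ = δ₀/(256·9^d)`, once `r(e_k)` (`= sM`) is large
  enough to absorb `2K₂` (p. 260: `r(e_k) = |log e_k⁻¹|^r → ∞`).
NOT HERE: the identification of `A` with `Δ_{j,loc}(u) + aL^{−2}Q(u)*Q(u)` and of `Ω, Λ` with `Λ^{(j)}_{10}`,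
`B_{m−j}(Λ^{(m)}_3)` (dictionary); the second sentence (*"all operators … satisfy this restriction"*) is bookkeeping of
the construction.  Distances in LABEL units (`1` label `= M` lattice units).  No `def`, no `Prop` fact, no `sorry`.
-/

namespace Literature.MathematicalPhysics.QuantumFieldTheory.BalabanImbrieJaffe1984to88.BIJ88DirichletReplacement292

open scoped BigOperators
open Finset
open Literature.MathematicalPhysics.QuantumFieldTheory.Balaban1983to89
open Literature.MathematicalPhysics.QuantumFieldTheory.BalabanImbrieJaffe1984to88
open B4RandomWalk213 B4Sect5RandomWalk B4Sect5CubeBounds BIJ88RandomWalk242 BIJ88Eq242Lattice BIJ88Ineq246Lattice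
  BIJ88Eq248Lattice
open scoped Matrix

variable {d N : ℕ} {Ω Λ : Finset (Fin d → ℤ)} {γ₀ c₀ δ₀ : ℝ}

/-! ## §1 The two-factor (2.46): decay in `|x₁ − x₂|` AND in `|X|` -/

/-- **THE TWO-FACTOR BOUND ON `C_{Λ,X}`** for the `ℤ^d` operators of [6] (finite `Λ ⊂ ℤ^d`, `A` with (5.6), cubes
`M ≥ 5`, `M > K_R`, `M > Θ₁`, `θ_W(M) < 1`, `r(e_k)`-cubes of `s ≥ 1` labels, `ρ = s/4`):
`|C_{Λ,X}(x₁,x₂)| ≤ 2^dγ₀^{−1}(1−θ_W)^{−1}e^{3δ₀/16} · e^{−(δ₀/16)·sdist(x₁,x₂)} · e^{−(δ₀s/(128·9^d))·|X|}` — the shape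
*"e^{−c|x₁−x₂|}e^{−cr(e_k)|X|}"* of p. 292: a contributing walk of the class `X` has path length
`≥ (s/(8·9^d))|X| − 1` (`plen_ge_of_region`) and `≥ sdist(x₁,x₂) − 2` (`sdist_le_plen_add_two`), so `≥` the mean of the
two, and the class sums to a geometric tail (`abs_tsum_class_le`). [cite: BalabanImbrieJaffe1988, (5.7.10) p.292] -/
theorem abs_cX_lattice_le_two (hγ : 0 < γ₀) (hc : 0 ≤ c₀) (hδ : 0 < δ₀) {A : Matrix (B4.Idx Λ N) (B4.Idx Λ N) ℝ}
    (hA : B4.Hyp56 Λ A γ₀ c₀ δ₀) {M : ℕ} (hM : 5 ≤ M) (hMR : kR d N γ₀ c₀ δ₀ < M)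
    (hMθ : thetaConst d N γ₀ c₀ δ₀ < M) (hθW : thetaW d N γ₀ c₀ δ₀ M < 1) {s : ℕ} (hs : 0 < s)
    (X : Finset (Cubes M s Λ)) (x₁ x₂ : B4.Idx Λ N) :
    |cX (ldist (N := N) M) ((s : ℝ) / 4) (cubeOf M s) touch (fun ω y₁ y₂ => latticeCw M Λ N A ω y₁ y₂) X x₁ x₂|
      ≤ 2 ^ d * γ₀⁻¹ * (1 - thetaW d N γ₀ c₀ δ₀ M)⁻¹ * Real.exp (3 * δ₀ / 16)
          * Real.exp (-(δ₀ / 16) * sdist (N := N) M x₁ x₂)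
          * Real.exp (-(δ₀ * s / (128 * 9 ^ d)) * X.card) := by
  classical
  have hM0 : 0 < M := by omega
  set T : Set (Walk ↥(labels M Λ)) :=
    {ω | ¬ Near (ldist (N := N) M) ((s : ℝ) / 4) ω x₁ x₂ ∧ region (cubeOf M s) touch ω = X} with hT
  have hcX : cX (ldist (N := N) M) ((s : ℝ) / 4) (cubeOf M s) touch (fun ω y₁ y₂ => latticeCw M Λ N A ω y₁ y₂) X x₁ x₂
      = ∑' cc : LTup M Λ, (flatten ⁻¹' T).indicator (fun cc => term M A cc x₁ x₂) cc := by
    rw [← tsum_indicator_latticeCw_eq A T x₁ x₂]; rfl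
  set L : ℝ := (((s : ℝ) / (8 * 9 ^ d) * (X.card : ℝ) - 1) + (sdist (N := N) M x₁ x₂ - 2)) / 2 with hL
  have hSL : ∀ cc ∈ flatten ⁻¹' T, term M A cc x₁ x₂ ≠ 0 → L ≤ plen cc := by
    intro cc hcc hne
    obtain ⟨hfar, hreg⟩ := hcc
    have h1 := plen_ge_of_region hM0 hs A cc x₁ x₂ hne hfar X hreg
    have h2 := sdist_le_plen_add_two hM0 A cc x₁ x₂ hne
    rw [hL]
    linarith
  -- `|∑' F| ≤ ∑' |F|`: Mathlib's `norm_tsum_le_tsum_norm`, `‖·‖ = |·|` on `ℝ` rewritten syntactically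
  have hsum' : Summable fun cc : LTup M Λ => ‖(flatten ⁻¹' T).indicator (fun cc => term M A cc x₁ x₂) cc‖ := by
    simpa only [Real.norm_eq_abs] using (summable_abs_indicator_term hγ hc hδ hA hM hMR hMθ (flatten ⁻¹' T) x₁ x₂)
  have h1' := norm_tsum_le_tsum_norm hsum'
  have h1 : |∑' cc : LTup M Λ, (flatten ⁻¹' T).indicator (fun cc => term M A cc x₁ x₂) cc|
      ≤ ∑' cc : LTup M Λ, |(flatten ⁻¹' T).indicator (fun cc => term M A cc x₁ x₂) cc| := by
    simpa only [Real.norm_eq_abs] using h1'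
  have h2 := abs_tsum_class_le hγ hc hδ hA hM hMR hMθ hθW (flatten ⁻¹' T) L x₁ x₂ hSL
  rw [hcX]
  refine h1.trans (h2.trans (le_of_eq ?_))
  rw [hL, mul_assoc (2 ^ d * γ₀⁻¹ * (1 - thetaW d N γ₀ c₀ δ₀ M)⁻¹),
    mul_assoc (2 ^ d * γ₀⁻¹ * (1 - thetaW d N γ₀ c₀ δ₀ M)⁻¹), ← Real.exp_add, ← Real.exp_add]
  congr 2
  ring

/-! ## §2 *"we can write the difference as Σ_X C^{(j)′}(X)"* -/

/-- **THE DIFFERENCE OF TWO DIRICHLET RESTRICTIONS AS A SUM OVER CUBE REGIONS** (p. 292): for finite `Λ ⊆ Ω ⊂ ℤ^d`,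
`A` on `L²(Ω; ℝ^N)` with (5.6), cubes `M ≥ 5`, `M > K_R`, `M > Θ₁`, any radius `ρ` and cube system, and sites
`x₁, x₂ ∈ Λ` with `x₁` farther than `(ρ + 2)M` from `Ω∖Λ`:
`A^{−1}(x₁,x₂) − A_Λ^{−1}(x₁,x₂) = Σ_X [C_{Ω,X}(x₁,x₂) − Σ_{Y : ι(Y) = X} C_{Λ,Y}(x₁,x₂)]`, the sum over all sets `X` of
`r(e_k)`-cubes of `Ω` (`ι(Y)` = the push-forward `Y.image (eCube M s hΛ)` of a cube set of `Λ`) — (2.45) for `Ω`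
(`eq245_lattice`) and for `Λ` (`eq245_compress`), whose local parts cancel by (2.48) (`cLoc_eq_of_far`), the `Λ`-sum
regrouped along the injective push-forward. [cite: BalabanImbrieJaffe1988, (5.7.10) p.292] -/
theorem sub_eq_sum_diffTerm (hγ : 0 < γ₀) (hc : 0 ≤ c₀) (hδ : 0 < δ₀) {A : Matrix (B4.Idx Ω N) (B4.Idx Ω N) ℝ}
    (hA : B4.Hyp56 Ω A γ₀ c₀ δ₀) (hΛ : Λ ⊆ Ω) {M : ℕ} (hM : 5 ≤ M) (hMR : kR d N γ₀ c₀ δ₀ < M)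
    (hMθ : thetaConst d N γ₀ c₀ δ₀ < M) (s : ℕ) (ρ : ℝ) (x₁ x₂ : B4.Idx Λ N)
    (hfar : FarFromCompl M Ω Λ ρ (x₁.1 : Fin d → ℤ)) :
    (A⁻¹ : Matrix (B4.Idx Ω N) (B4.Idx Ω N) ℝ) (B4.inclIdx hΛ x₁) (B4.inclIdx hΛ x₂)
        - ((B4.compress hΛ A)⁻¹ : Matrix (B4.Idx Λ N) (B4.Idx Λ N) ℝ) x₁ x₂
      = ∑ X : Finset (Cubes M s Ω),
          (cX (ldist (N := N) M) ρ (cubeOf M s) touch (fun ω y₁ y₂ => latticeCw M Ω N A ω y₁ y₂) X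
              (B4.inclIdx hΛ x₁) (B4.inclIdx hΛ x₂)
            - ∑ Y ∈ Finset.univ.filter (fun Y : Finset (Cubes M s Λ) => Y.image (eCube M s hΛ) = X),
                cX (ldist (N := N) M) ρ (cubeOf M s) touch
                  (fun ω y₁ y₂ => latticeCw M Λ N (B4.compress hΛ A) ω y₁ y₂) Y x₁ x₂) := by
  classical
  have hM0 : 0 < M := by omega
  have hΩ := eq245_lattice hγ hc hδ hA hM hMR hMθ (ldist (N := N) M) ρ (cubeOf M s) touch
    (B4.inclIdx hΛ x₁) (B4.inclIdx hΛ x₂)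
  have hΛ' := eq245_compress hγ hc hδ hA hΛ hM hMR hMθ (ldist (N := N) M) ρ (cubeOf M s) touch x₁ x₂
  have hloc := cLoc_eq_of_far (N := N) hM0 hΛ A ρ x₁ x₂ hfar
  beta_reduce at hΩ hΛ'
  have hfib : ∑ Y : Finset (Cubes M s Λ), cX (ldist (N := N) M) ρ (cubeOf M s) touch
        (fun ω y₁ y₂ => latticeCw M Λ N (B4.compress hΛ A) ω y₁ y₂) Y x₁ x₂
      = ∑ X : Finset (Cubes M s Ω), ∑ Y ∈ Finset.univ.filter
          (fun Y : Finset (Cubes M s Λ) => Y.image (eCube M s hΛ) = X),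
          cX (ldist (N := N) M) ρ (cubeOf M s) touch
            (fun ω y₁ y₂ => latticeCw M Λ N (B4.compress hΛ A) ω y₁ y₂) Y x₁ x₂ :=
    (Finset.sum_fiberwise Finset.univ (fun Y : Finset (Cubes M s Λ) => Y.image (eCube M s hΛ)) _).symm
  rw [hΩ, hΛ', hloc, Finset.sum_sub_distrib, ← hfib]
  ring

/-! ## §3 Only the regions reaching the boundary contribute -/

/-- the fibre of the push-forward over `ι(Y)` is `{Y}` (the push-forward of cube sets is injective).
[cite: BalabanImbrieJaffe1988, (5.7.10) p.292] -/
theorem fiber_eq_singleton {M s : ℕ} (hΛ : Λ ⊆ Ω) (Y : Finset (Cubes (d := d) M s Λ)) :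
    Finset.univ.filter (fun Y' : Finset (Cubes M s Λ) => Y'.image (eCube M s hΛ) = Y.image (eCube M s hΛ)) = {Y} := by
  classical
  ext Y'
  simp only [Finset.mem_filter, Finset.mem_univ, true_and, Finset.mem_singleton]
  exact (Finset.image_injective (eCube_injective M s hΛ)).eq_iff

/-- the fibre over any `X` has at most one element. [cite: BalabanImbrieJaffe1988, (5.7.10) p.292] -/
theorem card_fiber_le_one {M s : ℕ} (hΛ : Λ ⊆ Ω) (X : Finset (Cubes (d := d) M s Ω)) :
    (Finset.univ.filter (fun Y : Finset (Cubes M s Λ) => Y.image (eCube M s hΛ) = X)).card ≤ 1 := by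
  classical
  refine Finset.card_le_one.mpr fun Y hY Y' hY' => ?_
  rw [Finset.mem_filter] at hY hY'
  exact Finset.image_injective (eCube_injective M s hΛ) (hY.2.trans hY'.2.symm)

/-- **THE FAR TERMS VANISH** ((2.48), first clause): for a cube set `Y` of `Λ` with `XFar` (every label of `Ω` whose
cube touches `Y` is a deep label of `Λ`), the difference term at `X = ι(Y)` is `C_{Ω,ι(Y)} − C_{Λ,Y} = 0`
(`BIJ88Eq248Lattice.cX_eq_of_far`) — only the `X` reaching `Ω∖Λ` contribute to the difference.
[cite: BalabanImbrieJaffe1988, (5.7.10) p.292] -/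
theorem diffTerm_eq_zero_of_far {M s : ℕ} (hM : 0 < M) (hΛ : Λ ⊆ Ω) (A : Matrix (B4.Idx Ω N) (B4.Idx Ω N) ℝ)
    (ρ : ℝ) {Y : Finset (Cubes (d := d) M s Λ)} (hY : XFar M s Ω Λ Y) (x₁ x₂ : B4.Idx Λ N) :
    cX (ldist (N := N) M) ρ (cubeOf M s) touch (fun ω y₁ y₂ => latticeCw M Ω N A ω y₁ y₂) (Y.image (eCube M s hΛ))
          (B4.inclIdx hΛ x₁) (B4.inclIdx hΛ x₂)
        - ∑ Y' ∈ Finset.univ.filter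
            (fun Y' : Finset (Cubes M s Λ) => Y'.image (eCube M s hΛ) = Y.image (eCube M s hΛ)),
            cX (ldist (N := N) M) ρ (cubeOf M s) touch
              (fun ω y₁ y₂ => latticeCw M Λ N (B4.compress hΛ A) ω y₁ y₂) Y' x₁ x₂ = 0 := by
  classical
  rw [fiber_eq_singleton hΛ Y, Finset.sum_singleton, cX_eq_of_far hM hΛ A ρ hY x₁ x₂, sub_self]

/-! ## §4 *"|C^{(j)′}(X, x₁, x₂)| ≦ e^{−c|x₁−x₂|}e^{−cr(e_k)|X|}"* -/

/-- the site distance is intrinsic: computed in `Ω` or in `Λ` it is the same number. [cite: BalabanImbrieJaffe1988, (2.47) p.265] -/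
theorem sdist_inclIdx {M : ℕ} (hΛ : Λ ⊆ Ω) (x₁ x₂ : B4.Idx Λ N) :
    sdist (N := N) M (B4.inclIdx hΛ x₁) (B4.inclIdx hΛ x₂) = sdist (N := N) M x₁ x₂ := rfl

/-- **THE BOUND ON THE DIFFERENCE TERMS** (p. 292, *"|C^{(j)′}(X, x₁, x₂)| ≦ e^{−c|x₁−x₂|}e^{−cr(e_k)|X|}"*), explicit
constants: for finite `Λ ⊆ Ω ⊂ ℤ^d`, `A` with (5.6), `M ≥ 5`, `M > K_R`, `M > Θ₁`, `θ_W(M) < 1`, `r(e_k)`-cubes of `s ≥ 1`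
labels, `ρ = s/4`, every cube set `X` of `Ω` and all `x₁, x₂ ∈ Λ`:
`|C′(X)(x₁,x₂)| ≤ 2K₂ · e^{−(δ₀/16)·sdist(x₁,x₂)} · e^{−(δ₀s/(128·9^d))·|X|}`, `K₂ = 2^dγ₀^{−1}(1−θ_W)^{−1}e^{3δ₀/16}` —
the two-factor (2.46) for `C_{Ω,X}` and, on the (at most one-element) fibre, for `C_{Λ,Y}` with `|Y| = |X|` ((5.6) passes
to `A_Λ`, `B6GOmega.hyp56_compress`). [cite: BalabanImbrieJaffe1988, (5.7.10) p.292] -/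
theorem abs_diffTerm_le (hγ : 0 < γ₀) (hc : 0 ≤ c₀) (hδ : 0 < δ₀) {A : Matrix (B4.Idx Ω N) (B4.Idx Ω N) ℝ}
    (hA : B4.Hyp56 Ω A γ₀ c₀ δ₀) (hΛ : Λ ⊆ Ω) {M : ℕ} (hM : 5 ≤ M) (hMR : kR d N γ₀ c₀ δ₀ < M)
    (hMθ : thetaConst d N γ₀ c₀ δ₀ < M) (hθW : thetaW d N γ₀ c₀ δ₀ M < 1) {s : ℕ} (hs : 0 < s)
    (X : Finset (Cubes M s Ω)) (x₁ x₂ : B4.Idx Λ N) :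
    |cX (ldist (N := N) M) ((s : ℝ) / 4) (cubeOf M s) touch (fun ω y₁ y₂ => latticeCw M Ω N A ω y₁ y₂) X
          (B4.inclIdx hΛ x₁) (B4.inclIdx hΛ x₂)
        - ∑ Y ∈ Finset.univ.filter (fun Y : Finset (Cubes M s Λ) => Y.image (eCube M s hΛ) = X),
            cX (ldist (N := N) M) ((s : ℝ) / 4) (cubeOf M s) touch
              (fun ω y₁ y₂ => latticeCw M Λ N (B4.compress hΛ A) ω y₁ y₂) Y x₁ x₂|
      ≤ 2 * (2 ^ d * γ₀⁻¹ * (1 - thetaW d N γ₀ c₀ δ₀ M)⁻¹ * Real.exp (3 * δ₀ / 16))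
          * Real.exp (-(δ₀ / 16) * sdist (N := N) M x₁ x₂)
          * Real.exp (-(δ₀ * s / (128 * 9 ^ d)) * X.card) := by
  classical
  set B : ℝ := (2 ^ d * γ₀⁻¹ * (1 - thetaW d N γ₀ c₀ δ₀ M)⁻¹ * Real.exp (3 * δ₀ / 16))
      * Real.exp (-(δ₀ / 16) * sdist (N := N) M x₁ x₂) * Real.exp (-(δ₀ * s / (128 * 9 ^ d)) * X.card) with hB
  -- the Ω-part
  have hΩ : |cX (ldist (N := N) M) ((s : ℝ) / 4) (cubeOf M s) touch (fun ω y₁ y₂ => latticeCw M Ω N A ω y₁ y₂) X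
        (B4.inclIdx hΛ x₁) (B4.inclIdx hΛ x₂)| ≤ B := by
    have h := abs_cX_lattice_le_two hγ hc hδ hA hM hMR hMθ hθW hs X (B4.inclIdx hΛ x₁) (B4.inclIdx hΛ x₂)
    rwa [sdist_inclIdx] at h
  -- the Λ-part: at most one `Y`, with `|Y| = |X|`
  have hAΛ : B4.Hyp56 Λ (B4.compress hΛ A) γ₀ c₀ δ₀ := B6GOmega.hyp56_compress hΛ hγ.le hc hδ.le hA
  set F := Finset.univ.filter (fun Y : Finset (Cubes M s Λ) => Y.image (eCube M s hΛ) = X) with hF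
  have hY : ∀ Y ∈ F, |cX (ldist (N := N) M) ((s : ℝ) / 4) (cubeOf M s) touch
        (fun ω y₁ y₂ => latticeCw M Λ N (B4.compress hΛ A) ω y₁ y₂) Y x₁ x₂| ≤ B := by
    intro Y hYF
    have hYX : Y.image (eCube M s hΛ) = X := (Finset.mem_filter.mp hYF).2
    have hcard : (Y.card : ℝ) = X.card := by
      rw [← hYX, Finset.card_image_of_injective _ (eCube_injective M s hΛ)]
    have h := abs_cX_lattice_le_two hγ hc hδ hAΛ hM hMR hMθ hθW hs Y x₁ x₂
    rwa [hcard] at h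
  have hsum : |∑ Y ∈ F, cX (ldist (N := N) M) ((s : ℝ) / 4) (cubeOf M s) touch
        (fun ω y₁ y₂ => latticeCw M Λ N (B4.compress hΛ A) ω y₁ y₂) Y x₁ x₂| ≤ B := by
    have hB0 : 0 ≤ B := by rw [hB]; positivity
    refine (Finset.abs_sum_le_sum_abs _ _).trans ?_
    refine (Finset.sum_le_sum hY).trans ?_
    rw [Finset.sum_const, nsmul_eq_mul]
    calc (F.card : ℝ) * B ≤ 1 * B :=
          mul_le_mul_of_nonneg_right (by exact_mod_cast card_fiber_le_one hΛ X) hB0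
      _ = B := one_mul B
  calc _ ≤ |cX (ldist (N := N) M) ((s : ℝ) / 4) (cubeOf M s) touch (fun ω y₁ y₂ => latticeCw M Ω N A ω y₁ y₂) X
            (B4.inclIdx hΛ x₁) (B4.inclIdx hΛ x₂)|
          + |∑ Y ∈ F, cX (ldist (N := N) M) ((s : ℝ) / 4) (cubeOf M s) touch
              (fun ω y₁ y₂ => latticeCw M Λ N (B4.compress hΛ A) ω y₁ y₂) Y x₁ x₂| := abs_sub _ _
    _ ≤ B + B := add_le_add hΩ hsum
    _ = 2 * (2 ^ d * γ₀⁻¹ * (1 - thetaW d N γ₀ c₀ δ₀ M)⁻¹ * Real.exp (3 * δ₀ / 16))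
          * Real.exp (-(δ₀ / 16) * sdist (N := N) M x₁ x₂)
          * Real.exp (-(δ₀ * s / (128 * 9 ^ d)) * X.card) := by rw [hB]; ring

/-- **THE PRINTED FORM** *"|C^{(j)′}(X, x₁, x₂)| ≦ e^{−c|x₁−x₂|}e^{−cr(e_k)|X|}"* (constants absorbed): if `r(e_k)` (here:
`s` labels) is large enough that `2K₂ ≤ e^{(δ₀/(256·9^d))·s}`, then for every cube set `X` of `Ω` and all `x₁, x₂ ∈ Λ`,
`|C′(X)(x₁,x₂)| ≤ e^{−(δ₀/16)·sdist(x₁,x₂)} · e^{−(δ₀/(256·9^d))·s·|X|}` (for `X = ∅` both parts vanish,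
`BIJ88Ineq246Walks.cX_empty`; for `|X| ≥ 1` half of the `|X|`-rate absorbs the prefactor).
[cite: BalabanImbrieJaffe1988, (5.7.10) p.292] -/
theorem abs_diffTerm_le_printed (hγ : 0 < γ₀) (hc : 0 ≤ c₀) (hδ : 0 < δ₀) {A : Matrix (B4.Idx Ω N) (B4.Idx Ω N) ℝ}
    (hA : B4.Hyp56 Ω A γ₀ c₀ δ₀) (hΛ : Λ ⊆ Ω) {M : ℕ} (hM : 5 ≤ M) (hMR : kR d N γ₀ c₀ δ₀ < M)
    (hMθ : thetaConst d N γ₀ c₀ δ₀ < M) (hθW : thetaW d N γ₀ c₀ δ₀ M < 1) {s : ℕ} (hs : 0 < s)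
    (hlarge : 2 * (2 ^ d * γ₀⁻¹ * (1 - thetaW d N γ₀ c₀ δ₀ M)⁻¹ * Real.exp (3 * δ₀ / 16))
      ≤ Real.exp (δ₀ * s / (256 * 9 ^ d)))
    (X : Finset (Cubes M s Ω)) (x₁ x₂ : B4.Idx Λ N) :
    |cX (ldist (N := N) M) ((s : ℝ) / 4) (cubeOf M s) touch (fun ω y₁ y₂ => latticeCw M Ω N A ω y₁ y₂) X
          (B4.inclIdx hΛ x₁) (B4.inclIdx hΛ x₂)
        - ∑ Y ∈ Finset.univ.filter (fun Y : Finset (Cubes M s Λ) => Y.image (eCube M s hΛ) = X),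
            cX (ldist (N := N) M) ((s : ℝ) / 4) (cubeOf M s) touch
              (fun ω y₁ y₂ => latticeCw M Λ N (B4.compress hΛ A) ω y₁ y₂) Y x₁ x₂|
      ≤ Real.exp (-(δ₀ / 16) * sdist (N := N) M x₁ x₂) * Real.exp (-(δ₀ * s / (256 * 9 ^ d)) * X.card) := by
  classical
  rcases X.eq_empty_or_nonempty with rfl | hne
  · -- both parts vanish for `X = ∅`
    have hF : Finset.univ.filter (fun Y : Finset (Cubes M s Λ) => Y.image (eCube M s hΛ) = ∅) = {∅} := by
      ext Y; simp [Finset.image_eq_empty]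
    rw [hF, Finset.sum_singleton, BIJ88Ineq246Walks.cX_empty, BIJ88Ineq246Walks.cX_empty, sub_self, abs_zero]
    positivity
  · have hcard : (1 : ℝ) ≤ X.card := by exact_mod_cast Finset.card_pos.mpr hne
    have h := abs_diffTerm_le hγ hc hδ hA hΛ hM hMR hMθ hθW hs X x₁ x₂
    refine h.trans ?_
    set K : ℝ := 2 * (2 ^ d * γ₀⁻¹ * (1 - thetaW d N γ₀ c₀ δ₀ M)⁻¹ * Real.exp (3 * δ₀ / 16)) with hK
    set E₁ : ℝ := Real.exp (-(δ₀ / 16) * sdist (N := N) M x₁ x₂) with hE₁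
    have hE₁0 : 0 ≤ E₁ := (Real.exp_pos _).le
    have hc' : 0 ≤ δ₀ * s / (256 * 9 ^ d) := by positivity
    -- `K·e^{−2c′|X|} ≤ e^{c′}·e^{−2c′|X|} ≤ e^{−c′|X|}` for `|X| ≥ 1`
    have hstep : K * Real.exp (-(δ₀ * s / (128 * 9 ^ d)) * X.card)
        ≤ Real.exp (-(δ₀ * s / (256 * 9 ^ d)) * X.card) := by
      calc K * Real.exp (-(δ₀ * s / (128 * 9 ^ d)) * X.card)
          ≤ Real.exp (δ₀ * s / (256 * 9 ^ d)) * Real.exp (-(δ₀ * s / (128 * 9 ^ d)) * X.card) :=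
            mul_le_mul_of_nonneg_right hlarge (Real.exp_pos _).le
        _ = Real.exp (δ₀ * s / (256 * 9 ^ d) - (δ₀ * s / (128 * 9 ^ d)) * X.card) := by
            rw [← Real.exp_add]; congr 1; ring
        _ ≤ Real.exp (-(δ₀ * s / (256 * 9 ^ d)) * X.card) := by
            rw [Real.exp_le_exp]
            have : δ₀ * s / (128 * 9 ^ d) = 2 * (δ₀ * s / (256 * 9 ^ d)) := by ring
            rw [this]
            nlinarith [hc', hcard]
    calc K * E₁ * Real.exp (-(δ₀ * s / (128 * 9 ^ d)) * X.card)
        = E₁ * (K * Real.exp (-(δ₀ * s / (128 * 9 ^ d)) * X.card)) := by ring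
      _ ≤ E₁ * Real.exp (-(δ₀ * s / (256 * 9 ^ d)) * X.card) := mul_le_mul_of_nonneg_left hstep hE₁0

end Literature.MathematicalPhysics.QuantumFieldTheory.BalabanImbrieJaffe1984to88.BIJ88DirichletReplacement292
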